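import Literature.NumberTheory.LFunctions.NymanBeurlingVectorsAsymptotics
import HarnessLib

/-!
# Asymptotics of Burnol's vectors, II: norms and cross terms

Continuation of `NymanBeurlingVectors.lean` / `NymanBeurlingVectorsAsymptotics.lean` (Burnol 2002,
Thm. 5.2 for the `k = 0` vectors, on the Mellin side). With `s = 1/2 + iτ`, `ρ = 1/2 + iγ`,
`L = L(λ) = -log λ → +∞` as `λ → 0⁺`, and `w(τ) = |r(1/2+iτ)|²`:

* `∫ |e^{iv} - 1|²/v² dv = 2π` (`integral_fejerFn`, from Mellin–Plancherel for `𝟙_{(λ,1]} t^{-ρ}`);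
* `(1/L) ∫ |k₁(s)|² dτ = ∫ |e^{iv}-1|²/v² · w(γ + v/L) dv → 2π w(γ)` (`tendsto_integral_norm_sq_burnolK1`);
* `(1/L) ∫ |k(s)|² dτ → 2π w(γ)` (`tendsto_integral_norm_sq_burnolK`), the `k₂`-contributions being
  `o(L)` by dominated convergence;
* `(1/L) ∫ |k_ρ(s)| |k_{ρ'}(s)| dτ → 0` for `ρ ≠ ρ'` (`tendsto_integral_norm_mul_norm_burnolK`).

## References

* J.-F. Burnol, *A lower bound in an approximation problem involving the zeros of the Riemann
  zeta function*, Adv. Math. 170 (2002), 56–70; arXiv:math/0103058, Thm. 5.2.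
-/

noncomputable section

open Complex Filter MeasureTheory Set Asymptotics
open scoped Real Topology ComplexConjugate

namespace Literature.NumberTheory.LFunctions

namespace BurnolVectors

/-! ## `L(λ) = -log λ` -/

/-- `L(λ) = log(1/λ) = -log λ`. [folklore] -/
def Lof (lam : ℝ) : ℝ := -Real.log lam

/-- `L(λ) → +∞` as `λ → 0⁺`. [folklore] -/
theorem tendsto_Lof : Tendsto Lof (𝓝[>] 0) atTop :=
  tendsto_neg_atBot_atTop.comp Real.tendsto_log_nhdsGT_zero

/-- `L(λ) > 0` for `0 < λ < 1`. [folklore] -/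
theorem Lof_pos {lam : ℝ} (h0 : 0 < lam) (h1 : lam < 1) : 0 < Lof lam := by
  unfold Lof; linarith [Real.log_neg h0 h1]

/-- Eventually (as `λ → 0⁺`) `0 < λ < 1`. [folklore] -/
theorem eventually_mem_Ioo : ∀ᶠ lam : ℝ in 𝓝[>] 0, lam ∈ Ioo (0 : ℝ) 1 :=
  Ioo_mem_nhdsGT one_pos

/-- A single point is Lebesgue-null: `τ ≠ γ` for a.e. `τ`. [folklore] -/
private lemma ae_ne_pt (γ : ℝ) : ∀ᵐ τ : ℝ, τ ≠ γ := by
  simp [ae_iff]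

/-! ## The Fejér-type kernel `|e^{iv} - 1|²/v²` -/

/-- `φ(v) = |e^{iv} - 1|²/v²` (value `0` at `v = 0`, a null set). [folklore] -/
def fejerFn (v : ℝ) : ℝ :=
  ‖Complex.exp (v * I) - 1‖ ^ 2 / v ^ 2

/-- `0 ≤ φ`. [folklore] -/
lemma fejerFn_nonneg (v : ℝ) : 0 ≤ fejerFn v := by unfold fejerFn; positivity

/-- `φ(v) ≤ 1`. [folklore] -/
lemma fejerFn_le_one (v : ℝ) : fejerFn v ≤ 1 := by
  unfold fejerFn
  rcases eq_or_ne v 0 with rfl | hv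
  · simp
  have h : ‖Complex.exp (v * I) - 1‖ ≤ |v| := by
    rw [mul_comm]; simpa [Real.norm_eq_abs] using Real.norm_exp_I_mul_ofReal_sub_one_le (x := v)
  rw [div_le_one (by positivity), ← sq_abs v]
  exact pow_le_pow_left₀ (norm_nonneg _) h 2

/-- `φ(v) ≤ 4/v²`. [folklore] -/
lemma fejerFn_le_div (v : ℝ) : fejerFn v ≤ 4 / v ^ 2 := by
  unfold fejerFn
  rcases eq_or_ne v 0 with rfl | hv
  · simp
  have h : ‖Complex.exp (v * I) - 1‖ ≤ 2 := by
    calc ‖Complex.exp (v * I) - 1‖ ≤ ‖Complex.exp (v * I)‖ + ‖(1 : ℂ)‖ := norm_sub_le _ _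
      _ = 2 := by rw [Complex.norm_exp_ofReal_mul_I, norm_one]; norm_num
  gcongr
  calc ‖Complex.exp (v * I) - 1‖ ^ 2 ≤ 2 ^ 2 := pow_le_pow_left₀ (norm_nonneg _) h 2
    _ = 4 := by norm_num

/-- `φ(v) ≤ 8 (1+v²)⁻¹`. [folklore] -/
lemma fejerFn_le_inv (v : ℝ) : fejerFn v ≤ 8 * (1 + v ^ 2)⁻¹ := by
  by_cases hv : |v| ≤ 1
  · have h1 := fejerFn_le_one v
    have : v ^ 2 ≤ 1 := by rw [← sq_abs]; nlinarith [abs_nonneg v]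
    rw [← div_eq_mul_inv, le_div_iff₀ (by positivity)]
    nlinarith
  · rw [not_le] at hv
    have h2 := fejerFn_le_div v
    have hv2 : 1 < v ^ 2 := by rw [← sq_abs]; nlinarith
    rw [← div_eq_mul_inv, le_div_iff₀ (by positivity)]
    rw [le_div_iff₀ (by positivity)] at h2
    nlinarith [fejerFn_nonneg v]

/-- `φ` is measurable. [folklore] -/
lemma measurable_fejerFn : Measurable fejerFn := by
  unfold fejerFn
  refine Measurable.div (by fun_prop) (by fun_prop)

/-- `φ` is integrable. [folklore] -/
theorem integrable_fejerFn : Integrable fejerFn :=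
  Integrable.mono' (integrable_inv_one_add_sq.const_mul 8) measurable_fejerFn.aestronglyMeasurable
    (Eventually.of_forall fun v ↦ by
      rw [Real.norm_eq_abs, abs_of_nonneg (fejerFn_nonneg v)]; exact fejerFn_le_inv v)

/-- **The model kernel on the line**: for `λ > 0`,
`‖(λ^{ρ-s} - 1)/(s-ρ)‖² = L² φ(L(τ-γ))`, `L = -log λ`. [folklore] -/
theorem norm_sq_kernel_line {lam : ℝ} (hlam : 0 < lam) (γ τ : ℝ) :
    ‖((lam : ℂ) ^ (((1 / 2 : ℂ) + γ * I) - ((1 / 2 : ℂ) + τ * I)) - 1) /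
        (((1 / 2 : ℂ) + τ * I) - ((1 / 2 : ℂ) + γ * I))‖ ^ 2 =
      Lof lam ^ 2 * fejerFn (Lof lam * (τ - γ)) := by
  rw [norm_div, norm_line_sub_line, cpow_rho_sub_line hlam, fejerFn, Lof, div_pow]
  rcases eq_or_ne (τ - γ) 0 with h | h
  · simp [h]
  rw [show (((τ - γ) * -Real.log lam : ℝ) : ℂ) * I = ((-Real.log lam * (τ - γ) : ℝ) : ℂ) * I by
    push_cast; ring]
  rw [mul_pow, sq_abs]
  rcases eq_or_ne (Real.log lam) 0 with hl | hl
  · simp [hl]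
  field_simp

/-- **`∫ φ = 2π`** (`∫ |e^{iv}-1|²/v² dv = 2π`): Mellin–Plancherel
(`Literature.Analysis.FunctionSpaces.integral_norm_sq_mellin_half_eq`) for `g = 𝟙_{(e⁻¹,1]} t^{-1/2}`,
whose Mellin transform on the line has `|𝓜g(1/2+iτ)|² = φ(τ)` and whose `L²`-norm is `1`. [folklore] -/
theorem integral_fejerFn : ∫ v : ℝ, fejerFn v = 2 * π := by
  set lam : ℝ := Real.exp (-1) with hlam
  have hlam0 : 0 < lam := Real.exp_pos _
  have hlam1 : lam ≤ 1 := by rw [hlam]; exact Real.exp_le_one_iff.2 (by norm_num)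
  have hL : Lof lam = 1 := by simp [Lof, hlam]
  obtain ⟨hint, hval⟩ := integral_norm_sq_gTrunc 0 hlam0 hlam1
  obtain ⟨-, hP⟩ := Literature.Analysis.FunctionSpaces.integral_norm_sq_mellin_half_eq
    (mellinConvergent_gTrunc 0 hlam0 (1 / 2)) hint
  rw [hval, hlam, Real.log_exp, neg_neg, mul_one] at hP
  rw [← hP]
  refine integral_congr_ae ?_
  filter_upwards [ae_ne_pt 0] with τ hτ
  have hs : (1 / 2 : ℂ) + τ * I ≠ (1 / 2 : ℂ) + (0 : ℝ) * I := fun h ↦ hτ (by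
    have := congrArg Complex.im h; simpa using this)
  rw [mellin_gTrunc 0 hlam0 hlam1 hs, ← RCLike.norm_conj, conj_mellin_gTrunc_kernel hlam0.le,
    norm_sq_kernel_line hlam0, hL]
  simp

/-! ## The weight `w(τ) = |r(1/2+iτ)|²` -/

/-- `w(τ) = ‖r(1/2+iτ)‖²`. [folklore] -/
def wR (τ : ℝ) : ℝ := ‖burnolR ((1 / 2 : ℂ) + τ * I)‖ ^ 2

/-- `w` is continuous. [folklore] -/
lemma continuous_wR : Continuous wR := (continuous_burnolR_line.norm).pow 2

/-- `0 ≤ w ≤ 64`. [folklore] -/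
lemma wR_le (τ : ℝ) : wR τ ≤ 64 := by
  unfold wR
  calc ‖burnolR ((1 / 2 : ℂ) + τ * I)‖ ^ 2 ≤ 8 ^ 2 :=
      pow_le_pow_left₀ (norm_nonneg _) (norm_burnolR_line_le τ) 2
    _ = 64 := by norm_num

/-- `0 ≤ w`. [folklore] -/
lemma wR_nonneg (τ : ℝ) : 0 ≤ wR τ := by unfold wR; positivity

/-- `w ≤ 64 (1+τ²)⁻¹`, so `w` is integrable. [folklore] -/
lemma wR_le_inv (τ : ℝ) : wR τ ≤ 64 * (1 + τ ^ 2)⁻¹ := by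
  unfold wR
  have h := norm_burnolR_line_le_inv τ
  have h1 : (1 + τ ^ 2)⁻¹ ≤ 1 := inv_le_one_of_one_le₀ (by nlinarith)
  calc ‖burnolR ((1 / 2 : ℂ) + τ * I)‖ ^ 2 ≤ (8 * (1 + τ ^ 2)⁻¹) ^ 2 :=
      pow_le_pow_left₀ (norm_nonneg _) h 2
    _ = 64 * (1 + τ ^ 2)⁻¹ * (1 + τ ^ 2)⁻¹ := by ring
    _ ≤ 64 * (1 + τ ^ 2)⁻¹ * 1 := by gcongr
    _ = 64 * (1 + τ ^ 2)⁻¹ := mul_one _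

/-- `w` is integrable. [folklore] -/
theorem integrable_wR : Integrable wR :=
  Integrable.mono' (integrable_inv_one_add_sq.const_mul 64) continuous_wR.aestronglyMeasurable
    (Eventually.of_forall fun τ ↦ by
      rw [Real.norm_eq_abs, abs_of_nonneg (wR_nonneg τ)]; exact wR_le_inv τ)

/-! ## `(1/L) ∫ |k₁|² → 2π w(γ)` -/

/-- `‖k₁(s)‖² = L² φ(L(τ-γ)) w(τ)` on the line. [folklore] -/
theorem norm_sq_burnolK1_line {lam : ℝ} (hlam : 0 < lam) (γ τ : ℝ) :
    ‖burnolK1 ((1 / 2 : ℂ) + γ * I) lam ((1 / 2 : ℂ) + τ * I)‖ ^ 2 =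
      Lof lam ^ 2 * fejerFn (Lof lam * (τ - γ)) * wR τ := by
  rw [burnolK1, mul_div_right_comm, norm_mul, mul_pow, norm_sq_kernel_line hlam, wR]

/-- **Rescaling identity**: for `0 < λ < 1`,
`(1/L) ∫ ‖k₁(s)‖² dτ = ∫ φ(v) w(γ + v/L) dv`. [folklore] -/
theorem integral_norm_sq_burnolK1_eq {lam : ℝ} (hlam : 0 < lam) (hlam1 : lam < 1) (γ : ℝ) :
    (Lof lam)⁻¹ * ∫ τ : ℝ, ‖burnolK1 ((1 / 2 : ℂ) + γ * I) lam ((1 / 2 : ℂ) + τ * I)‖ ^ 2 =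
      ∫ v : ℝ, fejerFn v * wR (γ + v / Lof lam) := by
  set L := Lof lam with hLdef
  have hL : 0 < L := Lof_pos hlam hlam1
  simp_rw [norm_sq_burnolK1_line hlam]
  have h1 : ∫ τ : ℝ, L ^ 2 * fejerFn (L * (τ - γ)) * wR τ =
      ∫ u : ℝ, L ^ 2 * fejerFn (L * u) * wR (γ + u) := by
    rw [← integral_add_right_eq_self (fun τ : ℝ ↦ L ^ 2 * fejerFn (L * (τ - γ)) * wR τ) γ]
    congr 1; funext u; ring_nf
  have h2 : ∫ v : ℝ, fejerFn v * wR (γ + v / L) =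
      ∫ v : ℝ, (fun u : ℝ ↦ fejerFn (L * u) * wR (γ + u)) (v / L) := by
    congr 1; funext v
    simp only
    rw [mul_div_cancel₀ _ hL.ne']
  rw [h1, h2, Measure.integral_comp_div (fun u : ℝ ↦ fejerFn (L * u) * wR (γ + u)) L, smul_eq_mul,
    abs_of_pos hL, ← integral_const_mul, ← integral_const_mul]
  congr 1; funext u
  field_simp

/-- **Main term** (Burnol, Thm. 5.2 for `k = 0`): `(1/L) ∫ ‖k₁(s)‖² dτ → 2π w(γ)` as `λ → 0⁺`
(dominated convergence: `φ(v) w(γ + v/L) → φ(v) w(γ)`, dominated by `64 φ`). [cite: Burnol2002, Thm. 5.2] -/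
theorem tendsto_integral_norm_sq_burnolK1 (γ : ℝ) :
    Tendsto (fun lam : ℝ ↦ (Lof lam)⁻¹ *
        ∫ τ : ℝ, ‖burnolK1 ((1 / 2 : ℂ) + γ * I) lam ((1 / 2 : ℂ) + τ * I)‖ ^ 2)
      (𝓝[>] 0) (𝓝 (2 * π * wR γ)) := by
  have hlim : Tendsto (fun lam : ℝ ↦ ∫ v : ℝ, fejerFn v * wR (γ + v / Lof lam)) (𝓝[>] 0)
      (𝓝 (∫ v : ℝ, fejerFn v * wR γ)) := by
    refine tendsto_integral_filter_of_dominated_convergence (fun v ↦ 64 * fejerFn v) ?_ ?_ ?_ ?_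
    · exact Eventually.of_forall fun lam ↦
        (measurable_fejerFn.mul (continuous_wR.measurable.comp (by fun_prop))).aestronglyMeasurable
    · refine Eventually.of_forall fun lam ↦ Eventually.of_forall fun v ↦ ?_
      rw [Real.norm_eq_abs, abs_of_nonneg (mul_nonneg (fejerFn_nonneg v) (wR_nonneg _)), mul_comm]
      exact mul_le_mul_of_nonneg_right (wR_le _) (fejerFn_nonneg v)
    · exact integrable_fejerFn.const_mul 64
    · refine Eventually.of_forall fun v ↦ ?_
      refine (tendsto_const_nhds.mul (continuous_wR.continuousAt.tendsto.comp ?_))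
      have : Tendsto (fun lam : ℝ ↦ γ + v / Lof lam) (𝓝[>] 0) (𝓝 (γ + 0)) :=
        tendsto_const_nhds.add (tendsto_const_nhds.div_atTop tendsto_Lof)
      rwa [add_zero] at this
  rw [integral_mul_const, integral_fejerFn] at hlim
  refine hlim.congr' ?_
  filter_upwards [eventually_mem_Ioo] with lam hlam
  exact (integral_norm_sq_burnolK1_eq hlam.1 hlam.2 γ).symm

/-! ## The `k₂` contributions are `o(L)` -/

/-- `|log λ| = L(λ)` for `0 < λ < 1`. [folklore] -/
lemma abs_log_eq_Lof {lam : ℝ} (h0 : 0 < lam) (h1 : lam < 1) : |Real.log lam| = Lof lam := by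
  rw [Lof, abs_of_neg (Real.log_neg h0 h1)]

/-- `L⁻¹ → 0` as `λ → 0⁺`. [folklore] -/
lemma tendsto_inv_Lof : Tendsto (fun lam : ℝ ↦ (Lof lam)⁻¹) (𝓝[>] 0) (𝓝 0) :=
  tendsto_inv_atTop_zero.comp tendsto_Lof

/-- Pointwise bounds on the line, packaged: with `D` from `exists_norm_burnolV_div_sub_one_le γ`,
for `0 < λ < 1`: `‖k₁‖ ≤ L ‖r‖`, `‖k₁‖ ≤ (2/|τ-γ|) ‖r‖`, `‖k₂‖ ≤ D ‖r‖`, `‖k‖ ≤ (min L (2/|τ-γ|) + D) ‖r‖`.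
[folklore] -/
theorem norm_burnolK_line_le {lam : ℝ} (h0 : 0 < lam) (h1 : lam < 1) {γ D : ℝ}
    (hD : ∀ τ : ℝ, ‖burnolV ((1 / 2 : ℂ) + τ * I) / burnolV ((1 / 2 : ℂ) + γ * I) - 1‖ ≤ D * |τ - γ|)
    (τ : ℝ) :
    ‖burnolK1 ((1 / 2 : ℂ) + γ * I) lam ((1 / 2 : ℂ) + τ * I)‖ ≤
        min (Lof lam) (2 / |τ - γ|) * ‖burnolR ((1 / 2 : ℂ) + τ * I)‖ ∧
      ‖burnolK2 ((1 / 2 : ℂ) + γ * I) lam ((1 / 2 : ℂ) + τ * I)‖ ≤ D * ‖burnolR ((1 / 2 : ℂ) + τ * I)‖ ∧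
      ‖burnolK ((1 / 2 : ℂ) + γ * I) lam ((1 / 2 : ℂ) + τ * I)‖ ≤
        (min (Lof lam) (2 / |τ - γ|) + D) * ‖burnolR ((1 / 2 : ℂ) + τ * I)‖ := by
  obtain ⟨h1a, h1b⟩ := norm_burnolK1_line_le h0 γ τ
  rw [abs_log_eq_Lof h0 h1] at h1a
  have hk1 : ‖burnolK1 ((1 / 2 : ℂ) + γ * I) lam ((1 / 2 : ℂ) + τ * I)‖ ≤
      min (Lof lam) (2 / |τ - γ|) * ‖burnolR ((1 / 2 : ℂ) + τ * I)‖ := by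
    rcases min_choice (Lof lam) (2 / |τ - γ|) with h | h <;> rw [h]
    · exact h1a
    · exact h1b
  have hk2 := norm_burnolK2_line_le h0 hD τ
  refine ⟨hk1, hk2, ?_⟩
  rw [burnolK_eq_add, add_mul]
  exact (norm_add_le _ _).trans (add_le_add hk1 hk2)

/-- **`(1/L) ∫ ‖k₂‖² → 0`** as `λ → 0⁺` (`∫ ‖k₂‖² ≤ D² ∫ w` is bounded). [folklore] -/
theorem tendsto_integral_norm_sq_burnolK2 (γ : ℝ) :
    Tendsto (fun lam : ℝ ↦ (Lof lam)⁻¹ *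
        ∫ τ : ℝ, ‖burnolK2 ((1 / 2 : ℂ) + γ * I) lam ((1 / 2 : ℂ) + τ * I)‖ ^ 2)
      (𝓝[>] 0) (𝓝 0) := by
  obtain ⟨D, hD0, hD⟩ := exists_norm_burnolV_div_sub_one_le γ
  have hbound : ∀ lam : ℝ, 0 < lam →
      ∫ τ : ℝ, ‖burnolK2 ((1 / 2 : ℂ) + γ * I) lam ((1 / 2 : ℂ) + τ * I)‖ ^ 2 ≤ D ^ 2 * ∫ τ, wR τ := by
    intro lam hlam
    rw [← integral_const_mul]
    refine integral_mono_of_nonneg (Eventually.of_forall fun τ ↦ by positivity)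
      (integrable_wR.const_mul _) (Eventually.of_forall fun τ ↦ ?_)
    have h := norm_burnolK2_line_le hlam hD τ
    calc ‖burnolK2 ((1 / 2 : ℂ) + γ * I) lam ((1 / 2 : ℂ) + τ * I)‖ ^ 2
        ≤ (D * ‖burnolR ((1 / 2 : ℂ) + τ * I)‖) ^ 2 := pow_le_pow_left₀ (norm_nonneg _) h 2
      _ = D ^ 2 * wR τ := by rw [wR]; ring
  have hlim : Tendsto (fun lam : ℝ ↦ (Lof lam)⁻¹ * (D ^ 2 * ∫ τ, wR τ)) (𝓝[>] 0) (𝓝 0) := by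
    simpa using tendsto_inv_Lof.mul_const (D ^ 2 * ∫ τ, wR τ)
  refine squeeze_zero' ?_ ?_ hlim
  · filter_upwards [eventually_mem_Ioo] with lam hlam
    exact mul_nonneg (inv_nonneg.2 (Lof_pos hlam.1 hlam.2).le) (integral_nonneg fun τ ↦ by positivity)
  · filter_upwards [eventually_mem_Ioo] with lam hlam
    exact mul_le_mul_of_nonneg_left (hbound lam hlam.1) (inv_nonneg.2 (Lof_pos hlam.1 hlam.2).le)

/-- Measurability of `τ ↦ ‖k₁(s)‖`, `‖k₂(s)‖`, `‖k(s)‖` (from `NymanBeurlingVectors.lean`). [folklore] -/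
lemma measurable_norms (γ lam : ℝ) :
    Measurable (fun τ : ℝ ↦ ‖burnolK1 ((1 / 2 : ℂ) + γ * I) lam ((1 / 2 : ℂ) + τ * I)‖) ∧
    Measurable (fun τ : ℝ ↦ ‖burnolK2 ((1 / 2 : ℂ) + γ * I) lam ((1 / 2 : ℂ) + τ * I)‖) ∧
    Measurable (fun τ : ℝ ↦ ‖burnolK ((1 / 2 : ℂ) + γ * I) lam ((1 / 2 : ℂ) + τ * I)‖) :=
  ⟨(measurable_burnolK1_line γ lam).norm, (measurable_burnolK2_line γ lam).norm,
    (measurable_burnolK_line γ lam).norm⟩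

/-- **`(1/L) ∫ ‖k₁‖ ‖k₂‖ → 0`** as `λ → 0⁺` (dominated convergence: the integrand is `≤ D w` and tends to
`0` off `τ = γ`). [folklore] -/
theorem tendsto_integral_norm_burnolK1_mul_norm_burnolK2 (γ : ℝ) :
    Tendsto (fun lam : ℝ ↦ (Lof lam)⁻¹ *
        ∫ τ : ℝ, ‖burnolK1 ((1 / 2 : ℂ) + γ * I) lam ((1 / 2 : ℂ) + τ * I)‖ *
          ‖burnolK2 ((1 / 2 : ℂ) + γ * I) lam ((1 / 2 : ℂ) + τ * I)‖)
      (𝓝[>] 0) (𝓝 0) := by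
  obtain ⟨D, hD0, hD⟩ := exists_norm_burnolV_div_sub_one_le γ
  simp_rw [← integral_const_mul]
  have key := tendsto_integral_filter_of_dominated_convergence
    (F := fun (lam τ : ℝ) ↦ (Lof lam)⁻¹ * (‖burnolK1 ((1 / 2 : ℂ) + γ * I) lam ((1 / 2 : ℂ) + τ * I)‖ *
      ‖burnolK2 ((1 / 2 : ℂ) + γ * I) lam ((1 / 2 : ℂ) + τ * I)‖))
    (f := fun _ ↦ (0 : ℝ)) (l := 𝓝[>] (0 : ℝ)) (μ := volume) (fun τ ↦ D * wR τ) ?_ ?_ ?_ ?_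
  · rw [integral_zero] at key; exact key
  · refine Eventually.of_forall fun lam ↦ ?_
    obtain ⟨m1, m2, -⟩ := measurable_norms γ lam
    exact ((m1.mul m2).const_mul _).aestronglyMeasurable
  · filter_upwards [eventually_mem_Ioo] with lam hlam
    refine Eventually.of_forall fun τ ↦ ?_
    obtain ⟨hk1, hk2, -⟩ := norm_burnolK_line_le hlam.1 hlam.2 hD τ
    have hL := Lof_pos hlam.1 hlam.2
    rw [Real.norm_eq_abs, abs_of_nonneg (by positivity)]
    have hk1' : ‖burnolK1 ((1 / 2 : ℂ) + γ * I) lam ((1 / 2 : ℂ) + τ * I)‖ ≤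
        Lof lam * ‖burnolR ((1 / 2 : ℂ) + τ * I)‖ :=
      hk1.trans (mul_le_mul_of_nonneg_right (min_le_left _ _) (norm_nonneg _))
    calc (Lof lam)⁻¹ * (‖burnolK1 ((1 / 2 : ℂ) + γ * I) lam ((1 / 2 : ℂ) + τ * I)‖ *
          ‖burnolK2 ((1 / 2 : ℂ) + γ * I) lam ((1 / 2 : ℂ) + τ * I)‖)
        ≤ (Lof lam)⁻¹ * ((Lof lam * ‖burnolR ((1 / 2 : ℂ) + τ * I)‖) *
            (D * ‖burnolR ((1 / 2 : ℂ) + τ * I)‖)) := by gcongr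
      _ = D * wR τ := by rw [wR]; field_simp
  · exact integrable_wR.const_mul D
  · filter_upwards [ae_ne_pt γ] with τ hτ
    have hu : 0 < |τ - γ| := abs_pos.2 (sub_ne_zero.2 hτ)
    -- `0 ≤ F_λ(τ) ≤ L⁻¹ · (2/|u|) · 8 · D · 8 → 0`
    have hup : Tendsto (fun lam : ℝ ↦ (Lof lam)⁻¹ * ((2 / |τ - γ| * 8) * (D * 8))) (𝓝[>] 0) (𝓝 0) := by
      simpa using tendsto_inv_Lof.mul_const ((2 / |τ - γ| * 8) * (D * 8))
    refine squeeze_zero' ?_ ?_ hup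
    · filter_upwards [eventually_mem_Ioo] with lam hlam
      exact mul_nonneg (inv_nonneg.2 (Lof_pos hlam.1 hlam.2).le) (by positivity)
    · filter_upwards [eventually_mem_Ioo] with lam hlam
      obtain ⟨hk1, hk2, -⟩ := norm_burnolK_line_le hlam.1 hlam.2 hD τ
      have hr := norm_burnolR_line_le τ
      have hL := (Lof_pos hlam.1 hlam.2).le
      have e1 : ‖burnolK1 ((1 / 2 : ℂ) + γ * I) lam ((1 / 2 : ℂ) + τ * I)‖ ≤ 2 / |τ - γ| * 8 :=
        hk1.trans (mul_le_mul (min_le_right _ _) hr (norm_nonneg _) (by positivity))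
      have e2 : ‖burnolK2 ((1 / 2 : ℂ) + γ * I) lam ((1 / 2 : ℂ) + τ * I)‖ ≤ D * 8 :=
        hk2.trans (mul_le_mul_of_nonneg_left hr hD0.le)
      exact mul_le_mul_of_nonneg_left (mul_le_mul e1 e2 (norm_nonneg _) (by positivity))
        (inv_nonneg.2 hL)

/-- For reals: `|‖a+b‖² - ‖a‖²| ≤ 2‖a‖‖b‖ + ‖b‖²` (in any normed group). [folklore] -/
lemma abs_norm_sq_add_sub_le {E : Type*} [SeminormedAddCommGroup E] (a b : E) :
    |‖a + b‖ ^ 2 - ‖a‖ ^ 2| ≤ 2 * ‖a‖ * ‖b‖ + ‖b‖ ^ 2 := by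
  have h1 : ‖a + b‖ ≤ ‖a‖ + ‖b‖ := norm_add_le a b
  have h2 : ‖a‖ ≤ ‖a + b‖ + ‖b‖ := by
    have := norm_sub_le (a + b) b; rwa [add_sub_cancel_right] at this
  rw [abs_le]
  constructor <;> nlinarith [norm_nonneg a, norm_nonneg b, norm_nonneg (a + b)]

/-- **`(1/L) ∫ ‖k‖² → 2π w(γ)`** as `λ → 0⁺` (Burnol, Thm. 5.2, diagonal term for `k = 0`).
[cite: Burnol2002, Thm. 5.2] -/
theorem tendsto_integral_norm_sq_burnolK (γ : ℝ) :
    Tendsto (fun lam : ℝ ↦ (Lof lam)⁻¹ *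
        ∫ τ : ℝ, ‖burnolK ((1 / 2 : ℂ) + γ * I) lam ((1 / 2 : ℂ) + τ * I)‖ ^ 2)
      (𝓝[>] 0) (𝓝 (2 * π * wR γ)) := by
  obtain ⟨D, hD0, hD⟩ := exists_norm_burnolV_div_sub_one_le γ
  -- abbreviations
  set n1 : ℝ → ℝ → ℝ := fun lam τ ↦ ‖burnolK1 ((1 / 2 : ℂ) + γ * I) lam ((1 / 2 : ℂ) + τ * I)‖ with hn1
  set n2 : ℝ → ℝ → ℝ := fun lam τ ↦ ‖burnolK2 ((1 / 2 : ℂ) + γ * I) lam ((1 / 2 : ℂ) + τ * I)‖ with hn2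
  set n : ℝ → ℝ → ℝ := fun lam τ ↦ ‖burnolK ((1 / 2 : ℂ) + γ * I) lam ((1 / 2 : ℂ) + τ * I)‖ with hn
  -- integrability facts for `0 < λ < 1`
  have hint : ∀ lam : ℝ, 0 < lam → lam < 1 →
      Integrable (fun τ ↦ n1 lam τ ^ 2) ∧ Integrable (fun τ ↦ n2 lam τ ^ 2) ∧
        Integrable (fun τ ↦ n lam τ ^ 2) ∧ Integrable (fun τ ↦ n1 lam τ * n2 lam τ) := by
    intro lam h0 h1
    obtain ⟨m1, m2, m⟩ := measurable_norms γ lam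
    have hb := fun τ ↦ norm_burnolK_line_le h0 h1 hD τ
    have hL := Lof_pos h0 h1
    have i1 : Integrable (fun τ ↦ n1 lam τ ^ 2) := by
      refine Integrable.mono' (integrable_wR.const_mul (Lof lam ^ 2)) (m1.pow_const 2).aestronglyMeasurable
        (Eventually.of_forall fun τ ↦ ?_)
      rw [Real.norm_eq_abs, abs_of_nonneg (by positivity)]
      have := ((hb τ).1).trans (mul_le_mul_of_nonneg_right (min_le_left _ _) (norm_nonneg _))
      calc n1 lam τ ^ 2 ≤ (Lof lam * ‖burnolR ((1 / 2 : ℂ) + τ * I)‖) ^ 2 :=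
          pow_le_pow_left₀ (norm_nonneg _) this 2
        _ = Lof lam ^ 2 * wR τ := by rw [wR]; ring
    have i2 : Integrable (fun τ ↦ n2 lam τ ^ 2) := by
      refine Integrable.mono' (integrable_wR.const_mul (D ^ 2)) (m2.pow_const 2).aestronglyMeasurable
        (Eventually.of_forall fun τ ↦ ?_)
      rw [Real.norm_eq_abs, abs_of_nonneg (by positivity)]
      calc n2 lam τ ^ 2 ≤ (D * ‖burnolR ((1 / 2 : ℂ) + τ * I)‖) ^ 2 :=
          pow_le_pow_left₀ (norm_nonneg _) (hb τ).2.1 2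
        _ = D ^ 2 * wR τ := by rw [wR]; ring
    have i3 : Integrable (fun τ ↦ n lam τ ^ 2) := by
      refine Integrable.mono' (integrable_wR.const_mul ((Lof lam + D) ^ 2)) (m.pow_const 2).aestronglyMeasurable
        (Eventually.of_forall fun τ ↦ ?_)
      rw [Real.norm_eq_abs, abs_of_nonneg (by positivity)]
      have := ((hb τ).2.2).trans (mul_le_mul_of_nonneg_right
        (add_le_add (min_le_left _ _) (le_refl D)) (norm_nonneg _))
      calc n lam τ ^ 2 ≤ ((Lof lam + D) * ‖burnolR ((1 / 2 : ℂ) + τ * I)‖) ^ 2 :=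
          pow_le_pow_left₀ (norm_nonneg _) this 2
        _ = (Lof lam + D) ^ 2 * wR τ := by rw [wR]; ring
    have i4 : Integrable (fun τ ↦ n1 lam τ * n2 lam τ) := by
      refine Integrable.mono' (integrable_wR.const_mul (Lof lam * D)) (m1.mul m2).aestronglyMeasurable
        (Eventually.of_forall fun τ ↦ ?_)
      rw [Real.norm_eq_abs, abs_of_nonneg (by positivity)]
      have h1' := ((hb τ).1).trans (mul_le_mul_of_nonneg_right (min_le_left _ _) (norm_nonneg _))
      calc n1 lam τ * n2 lam τ ≤ (Lof lam * ‖burnolR ((1 / 2 : ℂ) + τ * I)‖) *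
            (D * ‖burnolR ((1 / 2 : ℂ) + τ * I)‖) := by
            refine mul_le_mul h1' (hb τ).2.1 (norm_nonneg _) (by positivity)
        _ = Lof lam * D * wR τ := by rw [wR]; ring
    exact ⟨i1, i2, i3, i4⟩
  -- the difference `(1/L)(∫ n² - ∫ n1²)` tends to zero
  have hdiff : Tendsto (fun lam : ℝ ↦ ((Lof lam)⁻¹ * ∫ τ : ℝ, n lam τ ^ 2) -
      ((Lof lam)⁻¹ * ∫ τ : ℝ, n1 lam τ ^ 2)) (𝓝[>] 0) (𝓝 0) := by
    have hb := (tendsto_integral_norm_burnolK1_mul_norm_burnolK2 γ).const_mul 2 |>.add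
      (tendsto_integral_norm_sq_burnolK2 γ)
    rw [mul_zero, zero_add] at hb
    refine squeeze_zero_norm' ?_ hb
    filter_upwards [eventually_mem_Ioo] with lam hlam
    obtain ⟨i1, i2, i3, i4⟩ := hint lam hlam.1 hlam.2
    have hL := Lof_pos hlam.1 hlam.2
    rw [← mul_sub, ← integral_sub i3 i1, Real.norm_eq_abs, abs_mul, abs_of_pos (inv_pos.2 hL)]
    rw [show (2 : ℝ) * ((Lof lam)⁻¹ * ∫ τ : ℝ, n1 lam τ * n2 lam τ) +
        (Lof lam)⁻¹ * (∫ τ : ℝ, n2 lam τ ^ 2) =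
        (Lof lam)⁻¹ * ((∫ τ : ℝ, 2 * (n1 lam τ * n2 lam τ)) + ∫ τ : ℝ, n2 lam τ ^ 2) by
      rw [integral_const_mul]; ring]
    rw [← integral_add (i4.const_mul 2) i2]
    refine mul_le_mul_of_nonneg_left ?_ (inv_pos.2 hL).le
    refine (abs_integral_le_integral_abs).trans (integral_mono (i3.sub i1).abs
      ((i4.const_mul 2).add i2) fun τ ↦ ?_)
    have := abs_norm_sq_add_sub_le (burnolK1 ((1 / 2 : ℂ) + γ * I) lam ((1 / 2 : ℂ) + τ * I))
      (burnolK2 ((1 / 2 : ℂ) + γ * I) lam ((1 / 2 : ℂ) + τ * I))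
    rw [← burnolK_eq_add] at this
    simpa [hn, hn1, hn2, mul_assoc] using this
  have := (tendsto_integral_norm_sq_burnolK1 γ).add hdiff
  rw [add_zero] at this
  refine this.congr' (Eventually.of_forall fun lam ↦ ?_)
  simp only [hn, hn1]
  ring

/-! ## Cross terms between distinct zeros are `o(L)` -/

/-- Eventually (as `λ → 0⁺`) `L(λ) ≥ 1`. [folklore] -/
theorem eventually_one_le_Lof : ∀ᶠ lam : ℝ in 𝓝[>] 0, 1 ≤ Lof lam :=
  tendsto_Lof.eventually (eventually_ge_atTop 1)

/-- Elementary: for `L ≥ 1`, `0 ≤ D, D'`, `0 < δ ≤ max |u| |u'|`·2… precisely, if `|u - u'| = δ > 0`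
then `L⁻¹ (min L (2/|u|) + D)(min L (2/|u'|) + D') ≤ 4/δ + D + D' + D D'`. [folklore] -/
lemma cross_bound_aux {L D D' u u' δ : ℝ} (hL : 1 ≤ L) (hD : 0 ≤ D) (hD' : 0 ≤ D') (hδ : 0 < δ)
    (huu' : δ ≤ |u - u'|) :
    L⁻¹ * ((min L (2 / |u|) + D) * (min L (2 / |u'|) + D')) ≤ 4 / δ + D + D' + D * D' := by
  have hL0 : 0 < L := by linarith
  set m := min L (2 / |u|) with hm
  set m' := min L (2 / |u'|) with hm'
  have hm0 : 0 ≤ m := le_min hL0.le (by positivity)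
  have hm0' : 0 ≤ m' := le_min hL0.le (by positivity)
  have hmL : m ≤ L := min_le_left _ _
  have hmL' : m' ≤ L := min_le_left _ _
  -- `min m m' ≤ 4/δ` since one of `|u|, |u'|` is `≥ δ/2`
  have hmin : m * m' ≤ L * (4 / δ) := by
    have h : δ / 2 ≤ |u| ∨ δ / 2 ≤ |u'| := by
      by_contra hcon
      simp only [not_or, not_le] at hcon
      have := abs_sub_le u 0 u'
      simp only [sub_zero, zero_sub, abs_neg] at this
      linarith
    rcases h with h | h
    · have hu : 0 < |u| := by linarith
      have h4 : m ≤ 4 / δ := (min_le_right _ _).trans (by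
        rw [div_le_div_iff₀ hu hδ]; linarith)
      have := mul_le_mul h4 hmL' hm0' (by positivity)
      linarith
    · have hu : 0 < |u'| := by linarith
      have h4 : m' ≤ 4 / δ := (min_le_right _ _).trans (by
        rw [div_le_div_iff₀ hu hδ]; linarith)
      exact mul_le_mul hmL h4 hm0' hL0.le
  rw [inv_mul_le_iff₀ hL0]
  have e : (m + D) * (m' + D') = m * m' + m * D' + D * m' + D * D' := by ring
  rw [e]
  have h1 : m * D' ≤ L * D' := mul_le_mul_of_nonneg_right hmL hD'
  have h2 : D * m' ≤ L * D := by nlinarith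
  have h3 : D * D' ≤ L * (D * D') := by
    have := mul_le_mul_of_nonneg_right hL (mul_nonneg hD hD')
    linarith
  nlinarith

/-- **Cross terms** (Burnol, Thm. 5.2, off-diagonal for `k = 0`): for `γ ≠ γ'`,
`(1/L) ∫ ‖k_γ(s)‖ ‖k_{γ'}(s)‖ dτ → 0` as `λ → 0⁺` (dominated convergence with the bound
`(4/|γ-γ'| + D + D' + DD') w`). [cite: Burnol2002, Thm. 5.2] -/
theorem tendsto_integral_norm_mul_norm_burnolK {γ γ' : ℝ} (hne : γ ≠ γ') :
    Tendsto (fun lam : ℝ ↦ (Lof lam)⁻¹ *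
        ∫ τ : ℝ, ‖burnolK ((1 / 2 : ℂ) + γ * I) lam ((1 / 2 : ℂ) + τ * I)‖ *
          ‖burnolK ((1 / 2 : ℂ) + γ' * I) lam ((1 / 2 : ℂ) + τ * I)‖)
      (𝓝[>] 0) (𝓝 0) := by
  obtain ⟨D, hD0, hD⟩ := exists_norm_burnolV_div_sub_one_le γ
  obtain ⟨D', hD0', hD'⟩ := exists_norm_burnolV_div_sub_one_le γ'
  set δ := |γ - γ'| with hδdef
  have hδ : 0 < δ := abs_pos.2 (sub_ne_zero.2 hne)
  set B := 4 / δ + D + D' + D * D' with hB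
  simp_rw [← integral_const_mul]
  have key := tendsto_integral_filter_of_dominated_convergence
    (F := fun (lam τ : ℝ) ↦ (Lof lam)⁻¹ * (‖burnolK ((1 / 2 : ℂ) + γ * I) lam ((1 / 2 : ℂ) + τ * I)‖ *
      ‖burnolK ((1 / 2 : ℂ) + γ' * I) lam ((1 / 2 : ℂ) + τ * I)‖))
    (f := fun _ ↦ (0 : ℝ)) (l := 𝓝[>] (0 : ℝ)) (μ := volume) (fun τ ↦ B * wR τ) ?_ ?_ ?_ ?_
  · rw [integral_zero] at key; exact key
  · refine Eventually.of_forall fun lam ↦ ?_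
    obtain ⟨-, -, m⟩ := measurable_norms γ lam
    obtain ⟨-, -, m'⟩ := measurable_norms γ' lam
    exact ((m.mul m').const_mul _).aestronglyMeasurable
  · filter_upwards [eventually_mem_Ioo, eventually_one_le_Lof] with lam hlam hL1
    refine Eventually.of_forall fun τ ↦ ?_
    obtain ⟨-, -, hk⟩ := norm_burnolK_line_le hlam.1 hlam.2 hD τ
    obtain ⟨-, -, hk'⟩ := norm_burnolK_line_le hlam.1 hlam.2 hD' τ
    have hL := Lof_pos hlam.1 hlam.2
    rw [Real.norm_eq_abs, abs_of_nonneg (by positivity)]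
    have huu' : δ ≤ |(τ - γ) - (τ - γ')| := by
      rw [show (τ - γ) - (τ - γ') = -(γ - γ') by ring, abs_neg]
    have hcb := cross_bound_aux hL1 hD0.le hD0'.le hδ huu'
    calc (Lof lam)⁻¹ * (‖burnolK ((1 / 2 : ℂ) + γ * I) lam ((1 / 2 : ℂ) + τ * I)‖ *
          ‖burnolK ((1 / 2 : ℂ) + γ' * I) lam ((1 / 2 : ℂ) + τ * I)‖)
        ≤ (Lof lam)⁻¹ * (((min (Lof lam) (2 / |τ - γ|) + D) * ‖burnolR ((1 / 2 : ℂ) + τ * I)‖) *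
            ((min (Lof lam) (2 / |τ - γ'|) + D') * ‖burnolR ((1 / 2 : ℂ) + τ * I)‖)) := by
          gcongr
      _ = (Lof lam)⁻¹ * ((min (Lof lam) (2 / |τ - γ|) + D) * (min (Lof lam) (2 / |τ - γ'|) + D')) *
            wR τ := by rw [wR]; ring
      _ ≤ B * wR τ := mul_le_mul_of_nonneg_right hcb (wR_nonneg τ)
  · exact integrable_wR.const_mul B
  · have hae : ∀ᵐ τ : ℝ, τ ≠ γ ∧ τ ≠ γ' := by
      filter_upwards [ae_ne_pt γ, ae_ne_pt γ'] with τ h1 h2; exact ⟨h1, h2⟩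
    filter_upwards [hae] with τ ⟨hτ, hτ'⟩
    have hu : 0 < |τ - γ| := abs_pos.2 (sub_ne_zero.2 hτ)
    have hu' : 0 < |τ - γ'| := abs_pos.2 (sub_ne_zero.2 hτ')
    have hup : Tendsto (fun lam : ℝ ↦ (Lof lam)⁻¹ *
        (((2 / |τ - γ| + D) * 8) * ((2 / |τ - γ'| + D') * 8))) (𝓝[>] 0) (𝓝 0) := by
      simpa using tendsto_inv_Lof.mul_const (((2 / |τ - γ| + D) * 8) * ((2 / |τ - γ'| + D') * 8))
    refine squeeze_zero' ?_ ?_ hup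
    · filter_upwards [eventually_mem_Ioo] with lam hlam
      exact mul_nonneg (inv_nonneg.2 (Lof_pos hlam.1 hlam.2).le) (by positivity)
    · filter_upwards [eventually_mem_Ioo] with lam hlam
      obtain ⟨-, -, hk⟩ := norm_burnolK_line_le hlam.1 hlam.2 hD τ
      obtain ⟨-, -, hk'⟩ := norm_burnolK_line_le hlam.1 hlam.2 hD' τ
      have hr := norm_burnolR_line_le τ
      have hL := (Lof_pos hlam.1 hlam.2).le
      have e1 : ‖burnolK ((1 / 2 : ℂ) + γ * I) lam ((1 / 2 : ℂ) + τ * I)‖ ≤ (2 / |τ - γ| + D) * 8 :=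
        hk.trans (mul_le_mul (add_le_add (min_le_right _ _) le_rfl) hr (norm_nonneg _) (by positivity))
      have e2 : ‖burnolK ((1 / 2 : ℂ) + γ' * I) lam ((1 / 2 : ℂ) + τ * I)‖ ≤ (2 / |τ - γ'| + D') * 8 :=
        hk'.trans (mul_le_mul (add_le_add (min_le_right _ _) le_rfl) hr (norm_nonneg _) (by positivity))
      exact mul_le_mul_of_nonneg_left (mul_le_mul e1 e2 (norm_nonneg _) (by positivity))
        (inv_nonneg.2 hL)

/-! ## Finite families of vectors -/

/-- `τ ↦ ‖k_γ(s)‖ ‖k_{γ'}(s)‖` is integrable (`≤ (L+D)(L+D') w`). [folklore] -/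
theorem integrable_norm_mul_norm_burnolK {lam : ℝ} (h0 : 0 < lam) (h1 : lam < 1) (γ γ' : ℝ) :
    Integrable fun τ : ℝ ↦ ‖burnolK ((1 / 2 : ℂ) + γ * I) lam ((1 / 2 : ℂ) + τ * I)‖ *
      ‖burnolK ((1 / 2 : ℂ) + γ' * I) lam ((1 / 2 : ℂ) + τ * I)‖ := by
  obtain ⟨D, hD0, hD⟩ := exists_norm_burnolV_div_sub_one_le γ
  obtain ⟨D', hD0', hD'⟩ := exists_norm_burnolV_div_sub_one_le γ'
  obtain ⟨-, -, m⟩ := measurable_norms γ lam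
  obtain ⟨-, -, m'⟩ := measurable_norms γ' lam
  have hL := Lof_pos h0 h1
  refine Integrable.mono' (integrable_wR.const_mul ((Lof lam + D) * (Lof lam + D')))
    (m.mul m').aestronglyMeasurable (Eventually.of_forall fun τ ↦ ?_)
  rw [Real.norm_eq_abs, abs_of_nonneg (by positivity)]
  obtain ⟨-, -, hk⟩ := norm_burnolK_line_le h0 h1 hD τ
  obtain ⟨-, -, hk'⟩ := norm_burnolK_line_le h0 h1 hD' τ
  have e1 := hk.trans (mul_le_mul_of_nonneg_right (add_le_add (min_le_left _ _) (le_refl D))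
    (norm_nonneg _))
  have e2 := hk'.trans (mul_le_mul_of_nonneg_right (add_le_add (min_le_left _ _) (le_refl D'))
    (norm_nonneg _))
  calc ‖burnolK ((1 / 2 : ℂ) + γ * I) lam ((1 / 2 : ℂ) + τ * I)‖ *
        ‖burnolK ((1 / 2 : ℂ) + γ' * I) lam ((1 / 2 : ℂ) + τ * I)‖
      ≤ ((Lof lam + D) * ‖burnolR ((1 / 2 : ℂ) + τ * I)‖) *
          ((Lof lam + D') * ‖burnolR ((1 / 2 : ℂ) + τ * I)‖) :=
        mul_le_mul e1 e2 (norm_nonneg _) (by positivity)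
    _ = (Lof lam + D) * (Lof lam + D') * wR τ := by rw [wR]; ring

/-- `τ ↦ ‖k_γ(s)‖²` is integrable. [folklore] -/
theorem integrable_norm_sq_burnolK {lam : ℝ} (h0 : 0 < lam) (h1 : lam < 1) (γ : ℝ) :
    Integrable fun τ : ℝ ↦ ‖burnolK ((1 / 2 : ℂ) + γ * I) lam ((1 / 2 : ℂ) + τ * I)‖ ^ 2 := by
  have := integrable_norm_mul_norm_burnolK h0 h1 γ γ
  refine this.congr (Eventually.of_forall fun τ ↦ ?_)
  simp only; ring

/-- Expansion of the square of a finite sum in `ℂ` (real inner products): the deviation of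
`‖∑ zᵢ‖²` from `∑ ‖zᵢ‖²` is at most the sum of the off-diagonal products. [folklore] -/
lemma abs_norm_sq_sum_sub_le {ι : Type*} [Fintype ι] [DecidableEq ι] (z : ι → ℂ) :
    |‖∑ i, z i‖ ^ 2 - ∑ i, ‖z i‖ ^ 2| ≤ ∑ i, ∑ j ∈ Finset.univ.erase i, ‖z i‖ * ‖z j‖ := by
  have hexp : ‖∑ i, z i‖ ^ 2 = ∑ i, ∑ j, @inner ℝ ℂ _ (z i) (z j) := by
    rw [← real_inner_self_eq_norm_sq, sum_inner]
    congr 1; funext i; rw [inner_sum]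
  have hsplit : ∀ i, ∑ j, @inner ℝ ℂ _ (z i) (z j) =
      ‖z i‖ ^ 2 + ∑ j ∈ Finset.univ.erase i, @inner ℝ ℂ _ (z i) (z j) := by
    intro i
    rw [← Finset.add_sum_erase _ _ (Finset.mem_univ i), real_inner_self_eq_norm_sq]
  rw [hexp]
  simp_rw [hsplit]
  rw [Finset.sum_add_distrib, add_sub_cancel_left]
  refine (Finset.abs_sum_le_sum_abs _ _).trans (Finset.sum_le_sum fun i _ ↦ ?_)
  exact (Finset.abs_sum_le_sum_abs _ _).trans (Finset.sum_le_sum fun j _ ↦ abs_real_inner_le_norm _ _)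

/-- Shorthand: `nK γ λ τ = ‖k_{1/2+iγ}(1/2+iτ)‖`. [folklore] -/
def nK (γ lam τ : ℝ) : ℝ := ‖burnolK ((1 / 2 : ℂ) + γ * I) lam ((1 / 2 : ℂ) + τ * I)‖

/-- `0 ≤ nK`. [folklore] -/
lemma nK_nonneg (γ lam τ : ℝ) : 0 ≤ nK γ lam τ := norm_nonneg _

/-- **`(1/L) ∫ ‖∑ cᵢ kᵢ(s)‖² dτ → 2π ∑ |cᵢ|² w(γᵢ)`** for distinct ordinates `γᵢ` (Burnol, Thm. 5.2
for `k = 0`: the rescaled Gram matrix tends to the diagonal). [cite: Burnol2002, Thm. 5.2] -/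
theorem tendsto_integral_norm_sq_sum_burnolK {ι : Type*} [Fintype ι] [DecidableEq ι]
    {γ : ι → ℝ} (hγ : Function.Injective γ) (c : ι → ℂ) :
    Tendsto (fun lam : ℝ ↦ (Lof lam)⁻¹ *
        ∫ τ : ℝ, ‖∑ i, c i * burnolK ((1 / 2 : ℂ) + γ i * I) lam ((1 / 2 : ℂ) + τ * I)‖ ^ 2)
      (𝓝[>] 0) (𝓝 (2 * π * ∑ i, ‖c i‖ ^ 2 * wR (γ i))) := by
  have hnz : ∀ (i : ι) (lam τ : ℝ), ‖c i * burnolK ((1 / 2 : ℂ) + γ i * I) lam ((1 / 2 : ℂ) + τ * I)‖ =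
      ‖c i‖ * nK (γ i) lam τ := fun i lam τ ↦ by rw [norm_mul, nK]
  -- the diagonal terms
  have hdiag : Tendsto (fun lam : ℝ ↦ ∑ i, ‖c i‖ ^ 2 * ((Lof lam)⁻¹ * ∫ τ : ℝ, nK (γ i) lam τ ^ 2))
      (𝓝[>] 0) (𝓝 (∑ i, ‖c i‖ ^ 2 * (2 * π * wR (γ i)))) :=
    tendsto_finsetSum _ fun i _ ↦ (tendsto_integral_norm_sq_burnolK (γ i)).const_mul _
  -- the off-diagonal terms
  have hoff : Tendsto (fun lam : ℝ ↦ ∑ i, ∑ j ∈ Finset.univ.erase i,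
      ‖c i‖ * ‖c j‖ * ((Lof lam)⁻¹ * ∫ τ : ℝ, nK (γ i) lam τ * nK (γ j) lam τ)) (𝓝[>] 0) (𝓝 0) := by
    have h := tendsto_finsetSum (Finset.univ : Finset ι) (fun i _ ↦
      tendsto_finsetSum (Finset.univ.erase i) fun j hj ↦
        (tendsto_integral_norm_mul_norm_burnolK (γ := γ i) (γ' := γ j)
          (fun h ↦ (Finset.mem_erase.1 hj).1 (hγ h).symm)).const_mul (‖c i‖ * ‖c j‖))
    have e0 : ∑ i : ι, ∑ j ∈ Finset.univ.erase i, ‖c i‖ * ‖c j‖ * (0 : ℝ) = 0 := by simp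
    rw [e0] at h
    exact h
  -- the difference is controlled by the off-diagonal terms
  have hdiff : Tendsto (fun lam : ℝ ↦ ((Lof lam)⁻¹ *
      ∫ τ : ℝ, ‖∑ i, c i * burnolK ((1 / 2 : ℂ) + γ i * I) lam ((1 / 2 : ℂ) + τ * I)‖ ^ 2) -
      ∑ i, ‖c i‖ ^ 2 * ((Lof lam)⁻¹ * ∫ τ : ℝ, nK (γ i) lam τ ^ 2)) (𝓝[>] 0) (𝓝 0) := by
    refine squeeze_zero_norm' ?_ hoff
    filter_upwards [eventually_mem_Ioo] with lam hlam
    have hL := Lof_pos hlam.1 hlam.2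
    -- integrability
    have I1 : ∀ i, Integrable (fun τ : ℝ ↦
        ‖c i * burnolK ((1 / 2 : ℂ) + γ i * I) lam ((1 / 2 : ℂ) + τ * I)‖ ^ 2) := fun i ↦
      ((integrable_norm_sq_burnolK hlam.1 hlam.2 (γ i)).const_mul (‖c i‖ ^ 2)).congr
        (Eventually.of_forall fun τ ↦ by simp only [hnz, mul_pow, nK])
    have I2 : ∀ i j, Integrable (fun τ : ℝ ↦
        ‖c i * burnolK ((1 / 2 : ℂ) + γ i * I) lam ((1 / 2 : ℂ) + τ * I)‖ *
        ‖c j * burnolK ((1 / 2 : ℂ) + γ j * I) lam ((1 / 2 : ℂ) + τ * I)‖) := fun i j ↦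
      ((integrable_norm_mul_norm_burnolK hlam.1 hlam.2 (γ i) (γ j)).const_mul (‖c i‖ * ‖c j‖)).congr
        (Eventually.of_forall fun τ ↦ by simp only [hnz, nK]; ring)
    have Isq : Integrable (fun τ : ℝ ↦
        ‖∑ i, c i * burnolK ((1 / 2 : ℂ) + γ i * I) lam ((1 / 2 : ℂ) + τ * I)‖ ^ 2) := by
      have hmem : MemLp (fun τ : ℝ ↦
          ∑ i, c i * burnolK ((1 / 2 : ℂ) + γ i * I) lam ((1 / 2 : ℂ) + τ * I)) 2 :=
        memLp_finsetSum _ fun i _ ↦ ((integrable_burnolK_line hlam.1 (γ i)).2.const_mul (c i))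
      exact (memLp_two_iff_integrable_sq_norm hmem.1).1 hmem
    have Isum : Integrable (fun τ : ℝ ↦
        ∑ i, ‖c i * burnolK ((1 / 2 : ℂ) + γ i * I) lam ((1 / 2 : ℂ) + τ * I)‖ ^ 2) :=
      integrable_finsetSum _ fun i _ ↦ I1 i
    -- the two sides as single integrals
    have e1 : ∑ i, ‖c i‖ ^ 2 * ((Lof lam)⁻¹ * ∫ τ : ℝ, nK (γ i) lam τ ^ 2) =
        (Lof lam)⁻¹ * ∫ τ : ℝ, ∑ i, ‖c i * burnolK ((1 / 2 : ℂ) + γ i * I) lam ((1 / 2 : ℂ) + τ * I)‖ ^ 2 := by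
      rw [integral_finsetSum _ fun i _ ↦ I1 i, Finset.mul_sum]
      refine Finset.sum_congr rfl fun i _ ↦ ?_
      have : ∫ τ : ℝ, ‖c i * burnolK ((1 / 2 : ℂ) + γ i * I) lam ((1 / 2 : ℂ) + τ * I)‖ ^ 2 =
          ‖c i‖ ^ 2 * ∫ τ : ℝ, nK (γ i) lam τ ^ 2 := by
        rw [← integral_const_mul]
        exact integral_congr_ae (Eventually.of_forall fun τ ↦ by simp only [hnz, mul_pow])
      rw [this]; ring
    have e2 : ∑ i, ∑ j ∈ Finset.univ.erase i, ‖c i‖ * ‖c j‖ *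
        ((Lof lam)⁻¹ * ∫ τ : ℝ, nK (γ i) lam τ * nK (γ j) lam τ) =
        (Lof lam)⁻¹ * ∫ τ : ℝ, ∑ i, ∑ j ∈ Finset.univ.erase i,
          ‖c i * burnolK ((1 / 2 : ℂ) + γ i * I) lam ((1 / 2 : ℂ) + τ * I)‖ *
          ‖c j * burnolK ((1 / 2 : ℂ) + γ j * I) lam ((1 / 2 : ℂ) + τ * I)‖ := by
      rw [integral_finsetSum _ fun i _ ↦ integrable_finsetSum _ fun j _ ↦ I2 i j, Finset.mul_sum]
      refine Finset.sum_congr rfl fun i _ ↦ ?_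
      rw [integral_finsetSum _ fun j _ ↦ I2 i j, Finset.mul_sum]
      refine Finset.sum_congr rfl fun j _ ↦ ?_
      have : ∫ τ : ℝ, ‖c i * burnolK ((1 / 2 : ℂ) + γ i * I) lam ((1 / 2 : ℂ) + τ * I)‖ *
          ‖c j * burnolK ((1 / 2 : ℂ) + γ j * I) lam ((1 / 2 : ℂ) + τ * I)‖ =
          ‖c i‖ * ‖c j‖ * ∫ τ : ℝ, nK (γ i) lam τ * nK (γ j) lam τ := by
        rw [← integral_const_mul]
        exact integral_congr_ae (Eventually.of_forall fun τ ↦ by simp only [hnz]; ring)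
      rw [this]; ring
    rw [e1, e2, ← mul_sub, ← integral_sub Isq Isum, Real.norm_eq_abs, abs_mul, abs_of_pos (inv_pos.2 hL)]
    refine mul_le_mul_of_nonneg_left ?_ (inv_pos.2 hL).le
    exact abs_integral_le_integral_abs.trans (integral_mono (Isq.sub Isum).abs
      (integrable_finsetSum _ fun i _ ↦ integrable_finsetSum _ fun j _ ↦ I2 i j)
      fun τ ↦ abs_norm_sq_sum_sub_le _)
  have := hdiag.add hdiff
  rw [add_zero] at this
  have e : ∑ i, ‖c i‖ ^ 2 * (2 * π * wR (γ i)) = 2 * π * ∑ i, ‖c i‖ ^ 2 * wR (γ i) := by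
    rw [Finset.mul_sum]; exact Finset.sum_congr rfl fun i _ ↦ by ring
  rw [e] at this
  refine this.congr' (Eventually.of_forall fun lam ↦ ?_)
  ring

/-! ## The pairings with `1/s`, summed over a finite family -/

/-- `τ ↦ k(s)/s` is integrable on the line, and `∫ k/s = ∫ k₁/s + ∫ k₂/s`. [folklore] -/
theorem integral_burnolK_div_eq_add {lam : ℝ} (hlam : 0 < lam) (γ : ℝ) :
    Integrable (fun τ : ℝ ↦ burnolK ((1 / 2 : ℂ) + γ * I) lam ((1 / 2 : ℂ) + τ * I) / ((1 / 2 : ℂ) + τ * I)) ∧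
    ∫ τ : ℝ, burnolK ((1 / 2 : ℂ) + γ * I) lam ((1 / 2 : ℂ) + τ * I) / ((1 / 2 : ℂ) + τ * I) =
      (∫ τ : ℝ, burnolK1 ((1 / 2 : ℂ) + γ * I) lam ((1 / 2 : ℂ) + τ * I) / ((1 / 2 : ℂ) + τ * I)) +
        ∫ τ : ℝ, burnolK2 ((1 / 2 : ℂ) + γ * I) lam ((1 / 2 : ℂ) + τ * I) / ((1 / 2 : ℂ) + τ * I) := by
  -- dividing an `L¹` function on the line by `s` (with `‖1/s‖ ≤ 2`) keeps it in `L¹`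
  have hdiv : ∀ {f : ℝ → ℂ}, Integrable f → Measurable f →
      Integrable (fun τ : ℝ ↦ f τ / ((1 / 2 : ℂ) + τ * I)) := by
    intro f hf hm
    refine Integrable.mono' (hf.norm.const_mul 2) (hm.div (by fun_prop)).aestronglyMeasurable
      (Eventually.of_forall fun τ ↦ ?_)
    rw [norm_div]
    have h := half_le_norm_line τ
    rw [div_le_iff₀ (by linarith)]
    nlinarith [norm_nonneg (f τ)]
  have h1 := hdiv (integrable_burnolK1_line hlam γ).1 (measurable_burnolK1_line γ lam)
  have h2 := hdiv (integrable_burnolK2_line hlam γ).1 (measurable_burnolK2_line γ lam)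
  have e : (fun τ : ℝ ↦ burnolK ((1 / 2 : ℂ) + γ * I) lam ((1 / 2 : ℂ) + τ * I) / ((1 / 2 : ℂ) + τ * I)) =
      fun τ : ℝ ↦ burnolK1 ((1 / 2 : ℂ) + γ * I) lam ((1 / 2 : ℂ) + τ * I) / ((1 / 2 : ℂ) + τ * I) +
        burnolK2 ((1 / 2 : ℂ) + γ * I) lam ((1 / 2 : ℂ) + τ * I) / ((1 / 2 : ℂ) + τ * I) := by
    funext τ; rw [burnolK_eq_add, add_div]
  rw [e]
  exact ⟨h1.add h2, integral_add h1 h2⟩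

/-- **Limit of the pairings** `∑ cᵢ ∫ kᵢ(s)/s dτ → ∑ cᵢ · 2π (ρᵢ - 1)/ρᵢ⁵` as `λ → 0⁺`
(Burnol, Thm. 5.3 for `k = 0`). [cite: Burnol2002, Thm. 5.3] -/
theorem tendsto_sum_integral_burnolK_div {ι : Type*} [Fintype ι] (γ : ι → ℝ) (c : ι → ℂ) :
    Tendsto (fun lam : ℝ ↦ ∑ i, c i *
        ∫ τ : ℝ, burnolK ((1 / 2 : ℂ) + γ i * I) lam ((1 / 2 : ℂ) + τ * I) / ((1 / 2 : ℂ) + τ * I))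
      (𝓝[>] 0) (𝓝 (∑ i, c i * (2 * π *
        ((((1 / 2 : ℂ) + γ i * I) - 1) / ((1 / 2 : ℂ) + γ i * I) ^ 5)))) := by
  refine tendsto_finsetSum _ fun i _ ↦ Tendsto.const_mul (c i) ?_
  have h := (tendsto_integral_burnolK1_div (γ i)).add (tendsto_integral_burnolK2_div (γ i))
  rw [add_zero] at h
  refine h.congr' ?_
  filter_upwards [self_mem_nhdsWithin] with lam (hlam : 0 < lam)
  exact ((integral_burnolK_div_eq_add hlam (γ i)).2).symm

end BurnolVectors

end Literature.NumberTheory.LFunctions
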